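import Mathlib
import Summits.Ventures.HodgeRepro.PeriodCloserC7

/-!
# PeriodCloserC7Identification — the ONE unprinted identification (i) of closer C7, refined into its
printed-shape components, with the composition proved on the kernel

Blind re-derivation cell `pub-hodge-repro`, seat night-2 (gen 2).  Target tree path
`lean/Summits/Ventures/HodgeRepro/PeriodCloserC7Identification.lean`.

`PeriodCloserC7.lean` (night-2 g0) types the period closer C7 (ROUTE.md §4 item 2) as an interface `C7Face L`
and proves the chain over it (`PeriodCloserC7Chain.lean`, `S4face_of_chain`).  Its ONE unprinted hypothesis is
`Identification I`: `doubling : ∀ d, I.hodgePairing d = I.torusPeriod d` (the `L²(X)` Hodge pairing of the two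
holomorphic `2`-forms IS the torus period of the Siegel–Eisenstein series `E^{(2,2)}(·, Φ_{1/2})`) and
`seesaw : I.P ↔ I.P'` — ROUTE.md §4 item 2's «(i) the identification of the L²(X) Hodge pairing with the torus
period (the cell's seesaw reading, §8.1/§8.4)», for which the route names no page.

This file opens that door as far as the held pages go (the operator's stance: a door is presumed; a REPAIR
CENSUS before any «blocked» line).  The identification is a COMPOSITION of identities each of which has a printed
shape on a held page; each is stated as a named `def … : Prop` over a small extension of the interface, with its
source quoted statement-exactly (key / page / lines as materialised by `lit read`), and the kernel PROVES that the
composition is `Identification I` (`identification_of_components`); `PeriodCloserC7IdentificationChain.lean` then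
runs `S4face_of_chain` from the components (`S4face_of_components`).  An interface theorem is exactly as strong as the logical chain it encodes:
every object below is a parameter; nothing here says anything about the status of the Hodge conjecture for CM
abelian varieties, which is NOT proved.

THE DOUBLING FORM, in five steps (Part I).  With `θ_j = θ_{W_j,V}(χ_j, φ_j)` the theta lift of the `U(1)`-character
of the line `W_j` (a holomorphic `1`-form on the Picard modular surface `X`; ROUTE.md §4 item 2: «each a wedge of
`p` Hecke-translated theta lifts (`H^{1,0}(X)` is spanned by theta lifts of characters of `U(1)`: BMM Cor 65,
Liu Prop 4.13)»):
* (D0) the pulled-back eigen-`1`-form `f^*ω_{j}` of the corner of the line `W_j` IS the theta lift `θ_j` — Liu 2021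
  Prop 4.13: `H^1_{B,τ′}(A_∞, ℂ) ≅ ⊕ ω(μ, ε, ν)` over the adèlic oscillator triples, the route's «`H^{1,0}(X)` is
  spanned by theta lifts of characters of `U(1)`» (`CornerLifts`, PRINTED as read);
* (D1) `f^*Ω_s = f^*ω_0 ∧ f^*ω_1`, `f^*Ω_{s̄} = f^*ω_2 ∧ f^*ω_3` — the route's construction of the witness forms
  (`WitnessForms`, ROUTE-CONSTRUCTION);
* (D2) `θ_{2i} ∧ θ_{2i+1}` is the `(T_i, χ_{2i} ⊗ χ_{2i+1})`-isotypic projection of the theta kernel of the plane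
  `W^{(i)} = W_{2i} ⊕ W_{2i+1}` — the cup-product compatibility of the theta forms, Bergeron 2006 Théorème 1.1, and
  the seesaw `U(W_{2i}) × U(W_{2i+1}) ⊂ U(W^{(i)})`, Kudla, *Notes*, IV.1 Example 1.2 (`CupProduct`, PRINTED SHAPE);
* (D3) the `L²(X)`-pairing of the two plane lifts is the `[T × T′]`-period of the theta integral on the doubled
  space `W ⊕ W′⁻` — N. Harris IMRN 2014 p0094:L48–50 (the Poisson-summation identity
  `θ(ι(g_1, g_2), h, ϕ) = θ(g_1, h, ϕ_1) θ(g_2, h, ϕ_2) γ^{-2}(det h)`) and the change of the order of integration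
  on the compact `[H]` (`DoublingIdentity`, PRINTED SHAPE);
* (D4) the theta integral IS the Siegel–Eisenstein series at `s = 1/2` — the extended Siegel–Weil formula, N. Harris
  p0090:L18–21 quoting Ichino 2007 Thm 1.1 (`SiegelWeil`, PRINTED as reported);
* and the definitional match `torusPeriod d = period d (eisenstein d)` (`TorusPeriodDef`).

THE SEESAW FORM, in three steps (Part II).  The `[U(W)]`-kernel decomposes along the finitely many
`τ ⊂ L²([U(W)])` of the level (`[U(W)]` compact), the lifts of non-isomorphic `τ` are orthogonal in `L²([U(V)])`
(Howe duality — Kudla, *Notes*, p0022:L19–p0023:L1 (iii), residue characteristic `≠ 2`; Gan–Takeda 2016 Thm 1.2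
for every `p` — and the route's multiplicity-one citation, Rogawski 1990), so
* (S1) `⟨f^*Ω_s, f^*Ω_{s̄}⟩ = Σ_τ ⟨θ_{W,V}(v_τ), θ_{W′,V}(v′_τ)⟩` with `v_τ ∈ τ̄` the vector representing the toric
  functional `𝒫_T(χ_0 ⊗ χ_1; ·)` on `τ` and `v′_τ` that of `𝒫_{T′}(χ_2 ⊗ χ_3; ·)` (`SpectralDecomposition`,
  PRINTED SHAPE);
* (S2) a non-zero `τ`-term forces `v_τ ≠ 0`, `v′_τ ≠ 0` and `θ_{W,V}(τ) ≠ 0` with its `(2,0)`-component — the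
  structural half of the Rallis inner product, N. Harris Thm 5.15 (`TermFactors`, STRUCTURAL);
* (S3) conversely a `τ` carrying both toric periods and a non-zero `(2,0)`-lift is isolated by a Hecke projection
  (`HeckeIsolation`, ROUTE-DERIVED: «for some choice of the Hecke translates») and its term made non-zero by the
  choice of the Schwartz data — the Rallis inner product formula, N. Harris Thm 5.15, with Gan–Qiu–Takeda 2014
  Prop 35 at the finite places and the archimedean `K`-type computation of ROUTE-B §9.8 (`RallisNonvanishing`,
  PRINTED SHAPE + ROUTE-DERIVED).

WHAT STAYS UNPRINTED AFTER THE SPLIT (honest list, the residual «door»): (a) the NORMALISATION MATCH between the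
Schwartz forms of Bergeron's theta series (the Kudla–Millson archimedean data of the `1`-forms) and the doubling
data `ϕ = σ(ϕ_1 ⊗ ϕ_2)` of Harris, including the constants `γ^{-2}(det h)`, the measures and the sign `i^{p²}` of
the projection formula; (b) that the corners' `1`-forms are theta lifts with exactly the datum's Kudla–Millson / level data (Liu Prop 4.13
gives the isotypic decomposition, the match of data is the route's reading); (c) the Hecke projection (S3a) for the finite spectrum of a definite `U(2)` (packets, not
strong multiplicity one); (d) the archimedean zeta integral with the fixed holomorphic vectors (ROUTE-B §9.8).
Each is a step of a standard method; none is a theorem of a held page for these objects.  Sources read AS PRINTED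
through `lit read` this gen: paper:doi-10-1093-imrn-rns219 pp. 88–95; paper:arxiv-math_0612447 pp. 3–4;
paper:galaxy-pdf-2227601490642563300 pp. 22–23, 43–44; paper:arxiv-1407.1995 p. 3; paper:arxiv-2102.11518 pp. 20–23.
-/

set_option autoImplicit false

noncomputable section

namespace Summit.Ventures.HodgeRepro.PeriodCloser

open NumberField

variable {L : Type} [Field L] [NumberField L] [IsCMField L]

/-- The four values of `line`: `line 0 0 = 0`, `line 0 1 = 1`, `line 1 0 = 2`, `line 1 1 = 3`. -/
theorem line_vals : line 0 0 = 0 ∧ line 0 1 = 1 ∧ line 1 0 = 2 ∧ line 1 1 = 3 := by decide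

/-! ## Part I — the doubling form `⟨f^*Ω_s, f^*Ω_{s̄}⟩_{L²(X)} = ∫_{[T×T′]} χ(t) E^{(2,2)}(ι(t), Φ_{1/2}) dt` -/

/-- **The doubling interface**: the objects of ROUTE-B §8.1 / §8.4 and N. Harris IMRN 2014 §5.4.4 through which
the identification (i) is computed, as parameters over the face interface — holomorphic forms on the ball
quotient `X` with their Hodge pairing and wedge product, the four line lifts and the two plane lifts of a datum,
the points of the torus quotient `[T × T′]` with the period functional of the datum, and the two automorphic
functions on `U(2,2)` restricted to it: the theta integral of the doubled space and the Siegel–Eisenstein series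
at `s = 1/2`. -/
structure DoublingInterface (I : C7Face L) where
  /-- holomorphic forms on `X` (the `1`-forms `θ_j` and the `2`-forms `θ_j ∧ θ_k`) -/
  Form : Type
  /-- the Hodge inner product `⟨·, ·⟩_{L²(X)}` -/
  hodge : Form → Form → ℂ
  /-- the wedge product of two holomorphic `1`-forms -/
  wedge : Form → Form → Form
  /-- the pulled-back eigen-`1`-forms `f^*ω_j` of the four corners of the datum (the corner of the line `W_j`,
  its eigen-`1`-form for the embedding `s` resp. `s̄`, pulled back along the Hecke-translated Albanese map) -/
  cornerForm : I.Datum → Fin 4 → Form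
  /-- the line lifts `θ_j = θ_{W_j,V}(χ_j, φ_j)` of the datum, `j = 0, …, 3` -/
  lineLift : I.Datum → Fin 4 → Form
  /-- the plane lifts: the `(T_i, χ_{2i} ⊗ χ_{2i+1})`-isotypic projection of the theta kernel of the pair
  `(U(W^{(i)}), U(V))`, `W^{(i)} = W_{2i} ⊕ W_{2i+1}`, as a `(2,0)`-form on `X` -/
  planeLift : I.Datum → Fin 2 → Form
  /-- the points of `[T × T′] = [U(W_0) × U(W_1) × U(W_2) × U(W_3)]` -/
  TorusPt : Type
  /-- the period functional `F ↦ ∫_{[T×T′]} (χ_0 ⊗ χ_1 ⊗ χ̄_2 ⊗ χ̄_3)(t) · F(t) dt` of the datum -/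
  period : I.Datum → (TorusPt → ℂ) → ℂ
  /-- the theta integral `I(ι(t), ϕ) = ∫_{[U(V)]} θ(ι(t), h, ϕ) γ^{-2}(det h) dh` of the doubled space `W ⊕ W′⁻`
  (N. Harris p0090:L4–8), restricted to `[T × T′]` -/
  thetaIntegral : I.Datum → TorusPt → ℂ
  /-- the Siegel–Eisenstein series `E(ι(t), Φ_{1/2})` on `U(2,2)` at the Siegel–Weil point (N. Harris
  p0088:L16–20), restricted to `[T × T′]` -/
  eisenstein : I.Datum → TorusPt → ℂ

/-- **(D0) PRINTED (as read) — the corners' `1`-forms are theta lifts of `U(1)`-characters.**  Liu, *Fourier–Jacobi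
cycles and arithmetic relative trace formula*, arXiv:2102.11518 (paper:arxiv-2102.11518), Proposition 4.13,
p0020:L53–L58 VERBATIM (OCR-damaged symbols restored from the context, Definitions 4.11–4.12 p0020:L28–L51):
«Suppose that `n ≥ 3`. Then for every embedding `τ′ : E → ℂ`, there is an isomorphism
`H^1_{B,τ′}(A_∞, ℂ) ≅ ⊕_{(μ,ε,ν)} ω(μ, ε, ν)` of `ℂ[U(𝔸_F^∞)]`-modules, where the direct sum is taken over all adèlic
oscillator triples in which `μ` is of weight one and `ε` is `μ`-admissible.»  With Corollary 4.20 p0023:L45–L56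
(the isogeny decomposition `A_K ∼ ∏_μ A_μ^{d(μ,K)}` of the Albanese over the conjugate-symplectic characters of
weight one, `n ≥ 3`).  SPECIALISED (the route's reading, ROUTE.md §4 item 2 «`H^{1,0}(X)` is spanned by theta lifts
of characters of `U(1)`: BMM Cor 65, Liu Prop 4.13»; §9.9 (c): «every admissible class contributes its own
summand, all of them `1`-forms pulled back from the same Albanese factor `A_μ`»): the eigen-`1`-form of the corner
of the line `W_j`, pulled back to `X`, lies in one `ω(μ_j, ε_j, ν_j)`-piece — the theta lift of the `U(1)`-character
`χ_j` of the line with the datum's finite data.  The match of the datum's Kudla–Millson / level data with this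
piece is residual (b) of the header. -/
def CornerLifts (I : C7Face L) (D : DoublingInterface I) : Prop :=
  ∀ (d : I.Datum) (j : Fin 4), D.cornerForm d j = D.lineLift d j

/-- **(D1) ROUTE-CONSTRUCTION — the witness forms** (ROUTE.md §4 item 2, «The witness»): `f^*Ω_s = Ω_s` pulled
back along the product of Hecke-translated Albanese maps is the wedge `f^*ω_0 ∧ f^*ω_1` of the eigen-`1`-forms of
the two corners containing `s`, and `f^*Ω_{s̄} = f^*ω_2 ∧ f^*ω_3` («`Ω_s := ∧_{i : s ∈ T_i} ω_{i,s}` — a wedge of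
`p` holomorphic eigen-`1`-forms, one from each corner containing `s`»); the Hodge pairing of the datum is the
pairing of the two wedges. -/
def WitnessForms (I : C7Face L) (D : DoublingInterface I) : Prop :=
  ∀ d : I.Datum,
    I.hodgePairing d =
      D.hodge (D.wedge (D.cornerForm d (line 0 0)) (D.cornerForm d (line 0 1)))
        (D.wedge (D.cornerForm d (line 1 0)) (D.cornerForm d (line 1 1)))

/-- **(D2) PRINTED SHAPE — the cup product of two theta lifts is a theta lift of the plane.**  Bergeron,
*Produits dans la cohomologie des variétés arithmétiques : quelques calculs sur les séries thêta*,
arXiv:math/0612447 (paper:arxiv-math_0612447), Théorème 1.1, p0003:L22–L38, VERBATIM (first bullet): «Les formes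
différentielles `φ^{(rq,sq)}` sont fermées vues comme formes différentielles sur `D` […] Elles sont non nulles pour
`0 ≤ r ≤ p` (et `0 ≤ s ≤ p`) et vérifient les propriétés suivantes. • Les formes sont compatibles avec le
cup-produit : `φ^{(r_1 q, s_1 q)} ∧ φ^{(r_2 q, s_2 q)} = φ^{((r_1 + r_2) q, (s_1 + s_2) q)}`, où `φ^{(rq,sq)} = 0` si
`r` ou `s` est strictement supérieur à `p`.»  And p0004:L5: «Il découle facilement du théorème (T1) et de la
construction que l'espace de ces séries thêta est stable par cup-produit et restriction.»  SPECIALISED (the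
cell's reading): `(p, q) = (2, 1)` for `U(V)` of signature `(2,1)`, two `(q, 0)`-forms (`r_1 = r_2 = 1`, `s = 0`,
`r_1 + r_2 = 2 ≤ p`) wedge to the `(2q, 0)`-form of the pair `(U(2), U(V))`, i.e. of the plane
`W^{(i)} = W_{2i} ⊕ W_{2i+1}`; the theta kernel of the plane restricted to `U(W_{2i}) × U(W_{2i+1})` is the
product of the two line kernels — the seesaw of Kudla, *Notes on the local theta correspondence*
(paper:galaxy-pdf-2227601490642563300) IV.1, Example 1.2 p0043:L21–29 («if `W = W_1 + W_2` is a direct sum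
decomposition […] we obtain a seesaw dual pair») with Lemma 1.3 p0044:L22–24 — so integrating the product against
`χ_{2i} ⊗ χ_{2i+1}` over `[T_i]` gives `θ_{2i} ∧ θ_{2i+1} = planeLift d i`.  The normalisation match between
Bergeron's Schwartz forms and the datum's Kudla–Millson data is NOT on a page (residual (a) of the header). -/
def CupProduct (I : C7Face L) (D : DoublingInterface I) : Prop :=
  ∀ (d : I.Datum) (i : Fin 2), D.wedge (D.lineLift d (line i 0)) (D.lineLift d (line i 1)) = D.planeLift d i

/-- **(D3) PRINTED SHAPE — the doubling identity.**  N. Harris, *The refined Gross–Prasad conjecture for unitary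
groups*, IMRN 2014 (paper:doi-10-1093-imrn-rns219), proof of Theorem 5.15, p0094:L48–50 VERBATIM: «Now we use a
Poisson summation formula `θ(ι(g_1, g_2), h, ϕ) = θ(g_1, h, ϕ_1) θ(g_2, h, ϕ_2) γ^{-2}(det h)` to obtain […]
`∫ θ(f̄_1, ϕ_1)(h) θ(f̄_2, ϕ_2)(h) E(h, Φ^{Aux}_s) dh`»; the change of the order of integration p0093:L50–52
(«θ(ι(g_1, g_2), h, ω_{ψ,γ}(z)ϕ) is rapidly decreasing on [H], and we may change the order of integration»), which
in the anisotropic case needs no regularisation: p0095:L4–6 «If W is anisotropic (so that [H] is compact), then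
the proof is much simpler; there is no need to regularize the Siegel-Weil formula in this case.»  SPECIALISED (the
cell's reading; Harris's `V` / `W` are the route's plane `W` / `3`-space `V`): the `L²(X)`-pairing of the two plane
lifts — each the `[T_i]`-integral of a line-product kernel against `χ_{2i} ⊗ χ_{2i+1}` — is, by the product
identity and Fubini on the compact `[U(V)] × [T] × [T′]`, the `[T × T′]`-period of the theta integral
`I(ι(t), ϕ ⊗ ϕ̄′)` of the doubled space `W ⊕ W′⁻` (N1: `W′ ≅ W`, the sealed isometry). -/
def DoublingIdentity (I : C7Face L) (D : DoublingInterface I) : Prop :=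
  ∀ d : I.Datum, D.hodge (D.planeLift d 0) (D.planeLift d 1) = D.period d (D.thetaIntegral d)

/-- **(D4) PRINTED (as reported) — the extended Siegel–Weil formula at `s = 1/2`.**  N. Harris IMRN 2014
p0090:L18–21 VERBATIM: «If `W` is anisotropic, and `Φ_s` is chosen such that `Φ_s(g) = |a(g)|^{s−1/2} ω_{ψ,γ}(g)ϕ(0)`,
then `E(g, Φ_s)` is holomorphic at `s = 1/2`, and the theta integral defined above converges.  Indeed, Theorem 1.1
of [19] says that `E(g, Φ_{1/2}) = I(g, ϕ)`.»  With p0088:L6–9: «If `W` is anisotropic, then `[H]` is compact, and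
the Rallis Inner Product Formula we need follows from a Siegel-Weil Formula (Theorem 1.1 in [19])»; [19] =
Ichino, *On the Siegel-Weil formula for unitary groups*, Math. Z. 255 (2007) (p0119:L23–24; NOT held).  The
identity is pointwise in `g ∈ U(2,2)(𝔸)`; the interface states it on `[T × T′]`. -/
def SiegelWeil (I : C7Face L) (D : DoublingInterface I) : Prop :=
  ∀ (d : I.Datum) (t : D.TorusPt), D.thetaIntegral d t = D.eisenstein d t

/-- **Definitional match**: the torus period of the face interface is the period functional of the datum applied
to the Siegel–Eisenstein series (ROUTE.md §4 item 2 (3): «the period of the Siegel–Eisenstein series on `U(2,2)`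
over the maximal anisotropic torus `∏_{i=0}^{3} U(W_i)` against the product character»). -/
def TorusPeriodDef (I : C7Face L) (D : DoublingInterface I) : Prop :=
  ∀ d : I.Datum, I.torusPeriod d = D.period d (D.eisenstein d)

/-- **The components of the doubling form**, bundled: (D0)–(D4) and the definitional match. -/
structure DoublingComponents (I : C7Face L) (D : DoublingInterface I) : Prop where
  /-- (D0) the corners' `1`-forms are the line lifts -/
  corner : CornerLifts I D
  /-- (D1) the witness forms -/
  forms : WitnessForms I D
  /-- (D2) the cup product / seesaw -/
  cup : CupProduct I D
  /-- (D3) the doubling identity -/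
  doubling : DoublingIdentity I D
  /-- (D4) the extended Siegel–Weil formula -/
  siegelWeil : SiegelWeil I D
  /-- the torus period of the interface -/
  torusDef : TorusPeriodDef I D

/-- **The doubling form of the identification, composed** (the field `Identification.doubling`): (D1) writes the
Hodge pairing as the pairing of the two wedges of corner forms, (D0) makes the corner forms line lifts, (D2) turns
each wedge into a plane lift, (D3) turns the pairing of the plane lifts into the period of the theta integral,
(D4) replaces the theta integral by the Siegel–Eisenstein series pointwise, and the definitional match reads off
the torus period. -/
theorem doubling_of_components (I : C7Face L) (D : DoublingInterface I) (H : DoublingComponents I D) :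
    ∀ d : I.Datum, I.hodgePairing d = I.torusPeriod d := by
  intro d
  rw [H.forms d, H.corner d (line 0 0), H.corner d (line 0 1), H.corner d (line 1 0), H.corner d (line 1 1),
    H.cup d 0, H.cup d 1, H.doubling d, H.torusDef d]
  congr 1
  funext t
  exact H.siegelWeil d t

/-- Under the doubling components, (P) is the non-vanishing of the torus period of `E^{(2,2)}(·, Φ_{1/2})` (the
route's «(P) is the non-vanishing of this ONE integral for some admissible data», §4 item 2 (3)). -/
theorem P_iff_torusPeriod_of_components (I : C7Face L) (D : DoublingInterface I)
    (H : DoublingComponents I D) : I.P ↔ I.TorusPeriodNonzero := by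
  unfold C7Face.P C7Face.TorusPeriodNonzero
  simp only [doubling_of_components I D H]

/-! ## Part II — the seesaw form `(P) ⟺ (P′)` -/

/-- **The spectral interface**: the finitely many `τ ⊂ L²([U(W)])` through which the kernel of a datum passes at
its level (`[U(W)]` compact, the spectrum discrete, the kernel `K`-finite), and the `τ`-term
`⟨θ_{W,V}(v_τ, φ), θ_{W′,V}(v′_τ, φ′)⟩_{L²(X)}` of the Hodge pairing, `v_τ ∈ τ̄` the vector representing the toric
functional `𝒫_T(χ_0 ⊗ χ_1; ·)` on `τ`, `v′_τ ∈ τ̄` that of `𝒫_{T′}(χ_2 ⊗ χ_3; ·)` (`U(W′) ≅ U(W)` by N1). -/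
structure SpectralInterface (I : C7Face L) where
  /-- the spectrum of the datum: the `τ` with a non-zero `K`-fixed vector at its level -/
  spectrum : I.Datum → Finset I.Tau
  /-- the `τ`-term of the Hodge pairing of the datum -/
  tauPairing : I.Datum → I.Tau → ℂ

/-- **(S1) PRINTED SHAPE — the spectral decomposition of the Hodge pairing.**  The kernel
`Θ_{W,V}(·, h; φ)` is, as a function on the compact quotient `[U(W)]`, a finite sum of its `τ`-components at the
level of the datum; so `f^*Ω_s = Σ_τ θ_{W,V}(v_τ, φ)` and `f^*Ω_{s̄} = Σ_τ θ_{W′,V}(v′_τ, φ′)`.  The cross terms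
vanish: non-isomorphic `τ_1, τ_2` have non-isomorphic lifts — Howe duality, Kudla, *Notes on the local theta
correspondence* (paper:galaxy-pdf-2227601490642563300) p0022:L19–L30 and p0023:L1 VERBATIM: «Howe Duality
Principle. (Howe, [46],[26], Waldspurger, [80]) Assume that the residue characteristic of F is not 2. Then, for any
irreducible admissible representation π of G̃ (i) Either Θ_ψ(π) = 0 or Θ_ψ(π) is an admissible representation of
G̃′ of finite length. (ii) If Θ_ψ(π) ≠ 0, There is a unique G̃′ invariant submodule Θ⁰_ψ(π) of Θ_ψ(π) such that the
quotient θ_ψ(π) := Θ_ψ(π)/Θ⁰_ψ(π) is irreducible. […] (iii) If θ_ψ(π_1) and θ_ψ(π_2) are nonzero and isomorphic,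
then π_1 ≃ π_2.»; for every residue characteristic Gan–Takeda, *A proof of the Howe duality conjecture*, JAMS 29
(2016), arXiv:1407.1995 (paper:arxiv-1407.1995) Theorem 1.2 p0003:L82–83 VERBATIM: «The Howe duality conjecture
(E:HD) holds for the pair G(W) × H(V).» — and isotypic components of non-isomorphic irreducible representations
are orthogonal in `L²([U(V)])` (the route cites multiplicity one for `U(V)`: Rogawski 1990 Prop 14.6.2, Thm 14.6.4,
Thm 14.6.5 — ROUTE.md §4 item 2 (2)).  The assembly is the route's reading (ROUTE-B §8.3). -/
def SpectralDecomposition (I : C7Face L) (S : SpectralInterface I) : Prop :=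
  ∀ d : I.Datum, I.hodgePairing d = ∑ τ ∈ S.spectrum d, S.tauPairing d τ

/-- **(S2) STRUCTURAL — a non-zero `τ`-term forces the three atoms of (P′).**  The `τ`-term
`⟨θ_{W,V}(v_τ, φ), θ_{W′,V}(v′_τ, φ′)⟩` vanishes if `v_τ = 0` (the toric period `𝒫_T(χ_0 ⊗ χ_1; ·)` is zero on
`τ`), if `v′_τ = 0`, or if the lift `θ_{W,V}(τ)` is zero or has no `(2,0)`-component pairing with the `(2,0)`-form
`f^*Ω_{s̄}`; so a non-zero term gives `toricPeriodNonzero 0`, `toricPeriodNonzero 1` and `liftNonzero τ`.  Its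
finer printed form is the Rallis inner product formula, N. Harris IMRN 2014 Theorem 5.15 p0092:L33–p0093:L14
VERBATIM: «Let π be an irreducible, cuspidal, automorphic representation of G(𝔸_F). Let f_1, f_2 ∈ π. Let
ϕ_1 ∈ S(X⁺(𝔸_F)) and ϕ_2 ∈ S(X⁻(𝔸_F)). Let θ(f̄_1, ϕ_1) and θ(f̄_2, ϕ_2) be the theta-lifts of f̄_1 and f̄_2 to
H(𝔸_F), and suppose these lifts are cuspidal. […] Set ϕ := σ(ϕ_1 ⊗ ϕ_2), and let Φ_s ∈ I(s, γ) be such that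
Φ_s(k) = (ω(k)ϕ)(0) for all k ∈ K. Then the following equality holds: ⟨θ(f̄_1, ϕ_1), θ(f̄_2, ϕ_2)⟩_{Θ(π̄)} =
L_E(1, BC(π) ⊗ γ³)/(ζ_F(2) L_F(3, χ_{E/F})) · ∏_v Z♯_v(1/2, f_{1,v}, f_{2,v}, Φ_{1/2,v}, γ³_v)» — bilinear in
`(f_1, f_2) = (v_τ, v′_τ)`. -/
def TermFactors (I : C7Face L) (S : SpectralInterface I) : Prop :=
  ∀ (d : I.Datum) (τ : I.Tau), S.tauPairing d τ ≠ 0 →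
    (∀ i : Fin 2, I.toricPeriodNonzero i d τ) ∧ I.liftNonzero τ

/-- **(S3a) ROUTE-DERIVED — Hecke isolation** (ROUTE.md §4 item 2: «for some choice of the Hecke translates»;
ROUTE-B §8.3): a `τ` of the spectrum carrying both toric periods can be isolated — a datum whose forms pass
through `τ` alone (a Hecke projection at the level, the characters of the datum unchanged, so the toric periods
are kept).  Residual (c) of the header: for the finite spectrum of a definite `U(2)` this is a projection inside
the full Hecke algebra of the level (the members of one `L`-packet are not separated by the unramified Hecke
operators), not a theorem of a held page. -/
def HeckeIsolation (I : C7Face L) (S : SpectralInterface I) : Prop :=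
  ∀ (d : I.Datum) (τ : I.Tau), (∀ i : Fin 2, I.toricPeriodNonzero i d τ) →
    ∃ d' : I.Datum, S.spectrum d' = {τ} ∧ ∀ i : Fin 2, I.toricPeriodNonzero i d' τ

/-- **(S3b) PRINTED SHAPE + ROUTE-DERIVED — the isolated `τ`-term can be made non-zero.**  On a datum whose
spectrum is `{τ}` with both toric periods non-zero (`v_τ ≠ 0`, `v′_τ ≠ 0`) and `liftNonzero τ`, the Rallis inner
product formula (N. Harris Thm 5.15, quoted at `TermFactors`) writes the term as the edge `L`-value — non-zero
(ROUTE.md §4 item 2 (2)(iii): «the L-value sits at the edge s = 1 and is non-zero») — times the local zeta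
integrals `Z♯_v`; these are non-zero for suitable Schwartz data at the finite places exactly where the local lifts
are non-zero (Gan–Qiu–Takeda 2014, arXiv:1207.4709 Prop 35(i) as restated in `PeriodCloserC7Lift.lean`), and at
the real places for the fixed holomorphic vectors by the `K`-type computation of ROUTE-B §9.8 (residual (d) of the
header).  Stated as: some datum with spectrum `{τ}` has a non-zero `τ`-term. -/
def RallisNonvanishing (I : C7Face L) (S : SpectralInterface I) : Prop :=
  ∀ (d : I.Datum) (τ : I.Tau), S.spectrum d = {τ} → (∀ i : Fin 2, I.toricPeriodNonzero i d τ) →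
    I.liftNonzero τ → ∃ d' : I.Datum, S.spectrum d' = {τ} ∧ S.tauPairing d' τ ≠ 0

/-- **(S3) — isolation with a non-zero term**, the composite of (S3a) and (S3b): a `τ` with both toric periods and
a non-zero `(2,0)`-lift is the whole spectrum of some datum whose `τ`-term is non-zero. -/
def IsolateTerm (I : C7Face L) (S : SpectralInterface I) : Prop :=
  ∀ (d : I.Datum) (τ : I.Tau), (∀ i : Fin 2, I.toricPeriodNonzero i d τ) → I.liftNonzero τ →
    ∃ d' : I.Datum, S.spectrum d' = {τ} ∧ S.tauPairing d' τ ≠ 0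

/-- (S3a) ∧ (S3b) ⟹ (S3). -/
theorem isolateTerm_of_hecke_rallis (I : C7Face L) (S : SpectralInterface I) (hH : HeckeIsolation I S)
    (hR : RallisNonvanishing I S) : IsolateTerm I S := by
  intro d τ hi hl
  obtain ⟨d₁, hs₁, hi₁⟩ := hH d τ hi
  exact hR d₁ τ hs₁ hi₁ hl

/-- **The components of the seesaw form**, bundled: (S1), (S2), (S3). -/
structure SeesawComponents (I : C7Face L) (S : SpectralInterface I) : Prop where
  /-- (S1) the spectral decomposition -/
  decomp : SpectralDecomposition I S
  /-- (S2) a non-zero term forces the atoms of (P′) -/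
  factors : TermFactors I S
  /-- (S3) isolation with a non-zero term -/
  isolate : IsolateTerm I S

/-- **(P) ⟹ (P′) from the components**: a non-zero Hodge pairing is a non-zero finite sum of `τ`-terms, so some
`τ`-term is non-zero, and (S2) gives the atoms of (P′) for that `τ`. -/
theorem P'_of_P_of_components (I : C7Face L) (S : SpectralInterface I) (H : SeesawComponents I S)
    (hP : I.P) : I.P' := by
  obtain ⟨d, hd⟩ := hP
  rw [H.decomp d] at hd
  obtain ⟨τ, -, hτ⟩ := Finset.exists_ne_zero_of_sum_ne_zero hd
  obtain ⟨hi, hl⟩ := H.factors d τ hτ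
  exact ⟨d, τ, hi, hl⟩

/-- **(P′) ⟹ (P) from the components**: the `τ` of (P′) is isolated with a non-zero term by (S3); on that datum
the Hodge pairing is that single term. -/
theorem P_of_P'_of_components (I : C7Face L) (S : SpectralInterface I) (H : SeesawComponents I S)
    (hP' : I.P') : I.P := by
  obtain ⟨d, τ, hi, hl⟩ := hP'
  obtain ⟨d', hs, hne⟩ := H.isolate d τ hi hl
  refine ⟨d', ?_⟩
  rw [H.decomp d', hs, Finset.sum_singleton]
  exact hne

/-- **The seesaw form of the identification, composed** (the field `Identification.seesaw`): (P) ⟺ (P′). -/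
theorem seesaw_of_components (I : C7Face L) (S : SpectralInterface I) (H : SeesawComponents I S) :
    I.P ↔ I.P' :=
  ⟨P'_of_P_of_components I S H, P_of_P'_of_components I S H⟩

/-! ## Part III — the identification from its components -/

/-- **THE IDENTIFICATION (i) FROM ITS COMPONENTS.**  The ONE unprinted hypothesis `Identification I` of the chain
follows from the eight named components (D0)–(D4) (+ the definitional match) and (S1)–(S3): the door of
ROUTE.md §4 item 2 (i) is the composition of identities each of which has a printed shape on a held page
(Bergeron 2006 Thm 1.1; Kudla *Notes* IV.1; N. Harris IMRN 2014 p0094:L48–50, p0090:L18–21, Thm 5.15; Howe duality,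
Gan–Takeda 2016 Thm 1.2) with the route-derived construction and the Hecke isolation, and the normalisation match
listed in the header as what stays unprinted. -/
theorem identification_of_components (I : C7Face L) (D : DoublingInterface I) (S : SpectralInterface I)
    (HD : DoublingComponents I D) (HS : SeesawComponents I S) : Identification I :=
  ⟨doubling_of_components I D HD, seesaw_of_components I S HS⟩

end Summit.Ventures.HodgeRepro.PeriodCloser

end
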